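import Literature.Computability.Complexity.SparseSetsUpwardSeparation
import Literature.Computability.Complexity.SparseSetsUpwardSeparationCodes
import Literature.Computability.Complexity.StackWords
import Mathlib.Data.Finset.Sort
import HarnessLib

/-!
# Upward separation, combinatorics of the census: chains, the enumeration, the membership formula

Topic `Literature/Computability/Complexity`, fourth proof file of the named fact
`hartmanisImmermanSewelson1985_thm1` (`SparseSetsUpwardSeparation.lean`), over the vocabulary of
`SparseSetsUpwardSeparationCodes.lean` (`UpSep.IsChain`, `UpSep.Cens`). The machine-free heart of the
upward separation method of Hartmanis–Immerman–Sewelson 1985 (proof of Thm. 1, Information and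
Control 65, p. 164):

> "Given `x` of length `n`, we first find the exact census of `S`, i.e., we find `cₙ = |Σⁿ ∩ S|` …
> `cₙ` will be the `i − 1`, where `i` is the least integer such that [no `i` members are listed] …
> Knowing the census `cₙ` … all of the `n#i₀#j₀#k#d` in `S'` will describe `x` … `x` will be in `S`
> if and only if for some pair `i₀` and `j₀` all of the appropriate `n#i₀#j₀#k#d` are in `S'`."

* `UpSep.IsChain.length_le_ncard` — a chain lists distinct members of the finite slice
  `S ∩ {0,1}ⁿ`, so it has at most census many items;
* `UpSep.exists_enum` — the sorted enumeration of the slice is a chain of census length containing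
  every member (`Finset.sort` of the binary values, written back by `natToWord`);
* `UpSep.IsChain.eq_of_length_eq` — two chains of census length coincide (`List.Perm.eq_of_pairwise`);
* **`UpSep.mem_iff_census`** — for any bounds `B₀ >` census, `B₁ i ≥ i`, `B₂ i j ≥ max n 1`:
  `x ∈ S ↔ ∃ i < B₀, ¬ Cens S n (i+1) 0 n 0 ∧ ∃ j < B₁ i, ∀ k < B₂ i j, Cens S n i j k x[k]`.

## References

* J. Hartmanis, N. Immerman, V. Sewelson, *Sparse sets in NP−P: EXPTIME versus NEXPTIME*,
  Information and Control 65 (1985) 158–181, Thm. 1, proof, p. 164 (held: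
  `paper:doi-10-1016-s0019-9958-85-80004-8`, PDF p. 7). [HartmanisImmermanSewelson1985]
-/

namespace Literature.Computability.Complexity

open _root_.Computability
open Literature.Barriers.PneNP (finite_slice)

namespace UpSep

/-! ### Combinatorics of chains: at most census many items; the enumeration; uniqueness -/

section Chains

variable {S : Language Bool} {n : ℕ}

/-- Consecutive strict increase propagates to all pairs of positions. [folklore] -/
theorem lt_of_consec {l : List ℕ} (h : ∀ m, m + 1 < l.length → l.getD m 0 < l.getD (m + 1) 0) :
    ∀ (j i : ℕ) (hij : i < j) (hj : j < l.length), l[i]'(lt_trans hij hj) < l[j]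
  | 0, _, hi, _ => absurd hi (Nat.not_lt_zero _)
  | j + 1, i, hi, hj => by
    have h2 := h j hj
    rw [List.getD_eq_getElem _ _ (Nat.lt_of_succ_lt hj), List.getD_eq_getElem _ _ hj] at h2
    rcases Nat.lt_succ_iff_lt_or_eq.1 hi with hij | rfl
    · exact (lt_of_consec h j i hij (Nat.lt_of_succ_lt hj)).trans h2
    · exact h2

/-- The values of a chain are pairwise increasing. [folklore] -/
theorem IsChain.pairwise {ys : List (List Bool)} (h : IsChain S n ys) :
    ys.Pairwise fun a b => bitsToNat a < bitsToNat b := by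
  have hc : ∀ m, m + 1 < (ys.map bitsToNat).length →
      (ys.map bitsToNat).getD m 0 < (ys.map bitsToNat).getD (m + 1) 0 := fun m hm => by
    rw [List.length_map] at hm
    rw [show (0 : ℕ) = bitsToNat [] from rfl, List.getD_map, List.getD_map]
    exact h.lt m hm
  have hp : (ys.map bitsToNat).Pairwise (· < ·) :=
    List.pairwise_iff_getElem.2 fun i j hi hj hij => lt_of_consec hc j i hij hj
  exact List.pairwise_map.1 hp

/-- A chain has no repeated item. [folklore] -/
theorem IsChain.nodup {ys : List (List Bool)} (h : IsChain S n ys) : ys.Nodup :=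
  h.pairwise.imp fun hab heq => by rw [heq] at hab; exact lt_irrefl _ hab

/-- The items of a chain lie in the slice `S ∩ {0,1}ⁿ`. [folklore] -/
theorem IsChain.mem_slice {ys : List (List Bool)} (h : IsChain S n ys) {y : List Bool} (hy : y ∈ ys) :
    y ∈ S ∧ y.length = n := by
  obtain ⟨m, hm, rfl⟩ := List.getElem_of_mem hy
  have h1 := h.mem m hm
  have h2 := h.len m hm
  rw [List.getD_eq_getElem _ _ hm] at h1 h2
  exact ⟨h1, h2⟩

/-- The items of a chain, as a finset inside the slice. [folklore] -/
theorem IsChain.toFinset_subset {ys : List (List Bool)} (h : IsChain S n ys) :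
    ys.toFinset ⊆ (finite_slice S n).toFinset := fun y hy => by
  rw [Set.Finite.mem_toFinset]
  exact h.mem_slice (List.mem_toFinset.1 hy)

/-- **A chain has at most census many items** (p. 164: "`cₙ` will be the `i − 1`, where `i` is the
least integer such that" no chain of `i` members exists). [cite: HartmanisImmermanSewelson1985, Theorem 1 (proof, p. 164)] -/
theorem IsChain.length_le_ncard {ys : List (List Bool)} (h : IsChain S n ys) :
    ys.length ≤ {x : List Bool | x ∈ S ∧ x.length = n}.ncard := by
  rw [Set.ncard_eq_toFinset_card _ (finite_slice S n), ← List.toFinset_card_of_nodup h.nodup]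
  exact Finset.card_le_card h.toFinset_subset

/-- A prefix of a chain is a chain. [folklore] -/
theorem IsChain.take {ys : List (List Bool)} (h : IsChain S n ys) (p : ℕ) : IsChain S n (ys.take p) := by
  have hg : ∀ m, m < (ys.take p).length → (ys.take p).getD m [] = ys.getD m [] := fun m hm => by
    rw [List.length_take] at hm
    rw [List.getD_eq_getElem _ _ (by rw [List.length_take]; exact hm),
      List.getD_eq_getElem _ _ (by omega), List.getElem_take]
  refine ⟨fun m hm => ?_, fun m hm => ?_, fun m hm => ?_⟩
  · rw [hg m hm]; exact h.mem m (by rw [List.length_take] at hm; omega)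
  · rw [hg m hm]; exact h.len m (by rw [List.length_take] at hm; omega)
  · rw [hg m (by omega), hg (m + 1) hm]
    exact h.lt m (by rw [List.length_take] at hm; omega)

/-- **The sorted enumeration of the slice is a chain of census length containing every member**
("assume that the elements of `S` are lexicographically ordered", p. 163 — here by binary value):
sort the values `bitsToNat` of the finitely many members of `S ∩ {0,1}ⁿ` and write them back as
words of length `n` (`natToWord`). [cite: HartmanisImmermanSewelson1985, Theorem 1 (proof, p. 163)] -/
theorem exists_enum (S : Language Bool) (n : ℕ) :
    ∃ ys : List (List Bool), IsChain S n ys ∧ ys.length = {x : List Bool | x ∈ S ∧ x.length = n}.ncard ∧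
      ∀ x : List Bool, x ∈ ys ↔ x ∈ S ∧ x.length = n := by
  classical
  set T : Finset (List Bool) := (finite_slice S n).toFinset with hT
  have hmemT : ∀ x, x ∈ T ↔ x ∈ S ∧ x.length = n := fun x => by rw [hT, Set.Finite.mem_toFinset]; rfl
  set K : Finset ℕ := T.image bitsToNat with hK
  set ks : List ℕ := K.sort (· ≤ ·) with hks
  have hinj : Set.InjOn bitsToNat (T : Set (List Bool)) := fun a ha b hb h =>
    bitsToNat_injOn_length n ((hmemT a).1 ha).2 ((hmemT b).1 hb).2 h
  have hmemks : ∀ v, v ∈ ks ↔ ∃ y ∈ T, bitsToNat y = v := fun v => by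
    rw [hks, Finset.mem_sort, hK, Finset.mem_image]
  have hsort : ks.Pairwise (· < ·) := List.sortedLT_iff_pairwise.1 (Finset.sortedLT_sort K)
  refine ⟨ks.map (natToWord n), ⟨fun m hm => ?_, fun m hm => ?_, fun m hm => ?_⟩, ?_, fun x => ?_⟩
  · -- members
    rw [List.length_map] at hm
    rw [List.getD_eq_getElem _ _ (by rw [List.length_map]; exact hm), List.getElem_map]
    obtain ⟨y, hy, hyv⟩ := (hmemks ks[m]).1 (List.getElem_mem hm)
    rw [← hyv, ← ((hmemT y).1 hy).2, natToWord_bitsToNat]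
    exact ((hmemT y).1 hy).1
  · -- lengths
    rw [List.length_map] at hm
    rw [List.getD_eq_getElem _ _ (by rw [List.length_map]; exact hm), List.getElem_map, length_natToWord]
  · -- increasing
    rw [List.length_map] at hm
    rw [List.getD_eq_getElem _ _ (by rw [List.length_map]; omega), List.getElem_map,
      List.getD_eq_getElem _ _ (by rw [List.length_map]; exact hm), List.getElem_map]
    have hv : ∀ p (hp : p < ks.length), bitsToNat (natToWord n ks[p]) = ks[p] := fun p hp => by
      obtain ⟨y, hy, hyv⟩ := (hmemks ks[p]).1 (List.getElem_mem hp)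
      rw [← hyv, ← ((hmemT y).1 hy).2, natToWord_bitsToNat]
    rw [hv m (by omega), hv (m + 1) hm]
    exact List.pairwise_iff_getElem.1 hsort m (m + 1) (by omega) hm (Nat.lt_succ_self m)
  · -- census many
    rw [List.length_map, hks, Finset.length_sort, hK, Finset.card_image_of_injOn hinj,
      Set.ncard_eq_toFinset_card _ (finite_slice S n)]
  · -- every member is listed
    rw [List.mem_map]
    constructor
    · rintro ⟨v, hv, rfl⟩
      obtain ⟨y, hy, rfl⟩ := (hmemks v).1 hv
      rw [← ((hmemT y).1 hy).2, natToWord_bitsToNat]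
      exact ⟨((hmemT y).1 hy).1, rfl⟩
    · intro hx
      refine ⟨bitsToNat x, (hmemks _).2 ⟨x, (hmemT x).2 hx, rfl⟩, ?_⟩
      rw [← hx.2, natToWord_bitsToNat]

/-- **Uniqueness: two chains of census length coincide** ("knowing the census `cₙ` … all of the
`n#i₀#j₀#k#d` in `S'` will describe `x`", p. 164): both list the whole slice without repetition,
in increasing order. [cite: HartmanisImmermanSewelson1985, Theorem 1 (proof, p. 164)] -/
theorem IsChain.eq_of_length_eq {ys zs : List (List Bool)} (hy : IsChain S n ys) (hz : IsChain S n zs)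
    (hly : ys.length = {x : List Bool | x ∈ S ∧ x.length = n}.ncard)
    (hlz : zs.length = {x : List Bool | x ∈ S ∧ x.length = n}.ncard) : ys = zs := by
  classical
  have hfull : ∀ {ws : List (List Bool)}, IsChain S n ws →
      ws.length = {x : List Bool | x ∈ S ∧ x.length = n}.ncard → ws.toFinset = (finite_slice S n).toFinset := by
    intro ws hw hlw
    refine Finset.eq_of_subset_of_card_le hw.toFinset_subset ?_
    rw [List.toFinset_card_of_nodup hw.nodup, hlw, Set.ncard_eq_toFinset_card _ (finite_slice S n)]
  have hperm : ys.Perm zs :=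
    List.perm_of_nodup_nodup_toFinset_eq hy.nodup hz.nodup ((hfull hy hly).trans (hfull hz hlz).symm)
  exact List.Perm.eq_of_pairwise (fun a b _ _ h₁ h₂ => absurd (h₁.trans h₂) (lt_irrefl _))
    hy.pairwise hz.pairwise hperm

end Chains

/-! ### The census formula for membership -/

/-- **Membership in a set through its census language** (Hartmanis–Immerman–Sewelson 1985, proof of
Thm. 1, p. 164: "Given `x` of length `n`, we first find the exact census of `S` … `x` will be in `S`
if and only if for some pair `i₀` and `j₀` all of the appropriate `n#i₀#j₀#k#d` are in `S'`"). With
the tree's naming: for ANY bounds `B₀ > census`, `B₁ i ≥ i`, `B₂ i j ≥ max n 1`,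
`x ∈ S ↔ ∃ i < B₀, ¬ Cens S n (i+1) 0 n 0 ∧ ∃ j < B₁ i, ∀ k < B₂ i j, Cens S n i j k x[k]`
(`n = |x|`): the first conjunct forces `i ≤ census`, any chain of length `i` forces `i ≥ census`,
so `i = census`, the chain is the enumeration, and the digit queries say `x` is its `j`-th item.
[cite: HartmanisImmermanSewelson1985, Theorem 1 (proof, p. 164)] -/
theorem mem_iff_census {S : Language Bool} {x : List Bool} {B₀ : ℕ} {B₁ : ℕ → ℕ} {B₂ : ℕ → ℕ → ℕ}
    (hB₀ : {y : List Bool | y ∈ S ∧ y.length = x.length}.ncard < B₀) (hB₁ : ∀ i, i ≤ B₁ i)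
    (hB₂ : ∀ i j, x.length ≤ B₂ i j) (hB₂' : ∀ i j, 1 ≤ B₂ i j) :
    x ∈ S ↔ ∃ i < B₀, ¬ Cens S x.length (i + 1) 0 x.length false ∧
      ∃ j < B₁ i, ∀ k < B₂ i j, Cens S x.length i j k (x.getD k false) := by
  set n := x.length with hn
  obtain ⟨E, hE, hEl, hEm⟩ := exists_enum S n
  set N := {y : List Bool | y ∈ S ∧ y.length = n}.ncard with hN
  -- `Cens S n (i+1) 0 n 0` says: a chain of length `i + 1` exists
  have hcens : ∀ i, Cens S n (i + 1) 0 n false ↔ ∃ ys, ys.length = i + 1 ∧ IsChain S n ys := fun i => by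
    unfold Cens
    exact ⟨fun ⟨_, ys, h1, h2, _⟩ => ⟨ys, h1, h2⟩,
      fun ⟨ys, h1, h2⟩ => ⟨Nat.succ_pos i, ys, h1, h2, fun h => absurd h (lt_irrefl n)⟩⟩
  constructor
  · intro hx
    obtain ⟨j, hj, hjx⟩ := List.getElem_of_mem ((hEm x).2 ⟨hx, rfl⟩)
    refine ⟨N, hB₀, ?_, j, lt_of_lt_of_le (lt_of_lt_of_eq hj hEl) (hB₁ N), fun k _ => ?_⟩
    · rw [hcens]
      rintro ⟨ys, hys, hch⟩
      have : ys.length ≤ N := hch.length_le_ncard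
      omega
    · refine ⟨lt_of_lt_of_eq hj hEl, E, hEl, hE, fun _ => ?_⟩
      rw [List.getD_eq_getElem _ _ hj, hjx]
  · rintro ⟨i, -, hno, j, -, hall⟩
    -- `i = N`
    have hNi : N ≤ i := by
      by_contra hlt
      have hEl' : E.length = N := hEl
      exact hno ((hcens i).2 ⟨E.take (i + 1), by rw [List.length_take]; omega, hE.take (i + 1)⟩)
    obtain ⟨hji, ys₀, hys₀, hch₀, -⟩ := hall 0 (hB₂' i j)
    have hiN : i ≤ N := by
      have : ys₀.length ≤ N := hch₀.length_le_ncard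
      omega
    have hi : i = N := le_antisymm hiN hNi
    subst hi
    -- every digit query is answered by the enumeration `E`
    have hjE : j < E.length := by rw [hEl]; exact hji
    have hdig : ∀ k, k < n → (E.getD j []).getD k false = x.getD k false := fun k hk => by
      obtain ⟨-, ys, hys, hch, hd⟩ := hall k (lt_of_lt_of_le hk (hB₂ _ j))
      rw [← hch.eq_of_length_eq hE hys hEl]
      exact hd hk
    have hlenj : (E.getD j []).length = n := hE.len j hjE
    have hEq : E.getD j [] = x := by
      refine List.ext_getElem (hlenj.trans hn) fun k hk1 hk2 => ?_
      have h := hdig k (by omega)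
      rwa [List.getD_eq_getElem _ _ hk1, List.getD_eq_getElem _ _ hk2] at h
    have hmem := hE.mem j hjE
    rwa [hEq] at hmem

end UpSep

end Literature.Computability.Complexity
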